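import Summits.AtomisticToContinuum.Crystallization.Theorems.ExcessDecayLiouvilleHcpLiouvilleBlowdownLevelsLow

/-!
# `ExcessDecayLiouville.HcpLiouville` (stmt-AtomisticToContinuum-9332), line `Sketch` (skeleton v4): Caccioppoli levels `2` and `3`

Helper for stub `stub_interior` (step (4) of the interior estimate for `L`-harmonic fields): the last two of the four
Caccioppoli levels for the localised field `ẑ` of an `L`-harmonic field on `B_R(c)` (`R ≥ 400`): `blowdown_level2`
(registered) bounds the energy of the double generator differences on `B_{12R/40−2}(c)` by `A₂ K³ R⁻⁶ W` and
`blowdown_level3` that of the triple differences on `B_{9R/40−2}(c)` by `A₃ K⁴ R⁻⁸ W` (notation of …LevelsLow; each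
level is `Blowdown.next_level` fed with the previous one, the forcing of the second differences being
`Blowdown.farField_sq_le₂`).
All `[folklore]`; a `--supports` helper for item stmt-AtomisticToContinuum-9332, nothing here closes an item.
-/

noncomputable section

namespace Summit.AtomisticToContinuum.Crystallization.Theorems.ExcessDecayLiouville

open scoped BigOperators Topology Classical InnerProductSpace RealInnerProductSpace
open Literature.MathematicalPhysics.StatisticalMechanics
open Summit.AtomisticToContinuum.Crystallization.Theses.ExcessDecayLiouville
open Summit.AtomisticToContinuum.Crystallization.Theorems.PhononStabilityNegative
open LevelOne

/-- **Level `2`**: the energy of each double generator difference of the localised field on `B_{12R/40 − 2}(c)` is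
`≤ A₂·K³·R⁻⁶·W`. [folklore] -/
theorem blowdown_level2 : ∀ (C_L κ K : ℝ) (t : Fin 2 → (EuclideanSpace ℝ (Fin 3))) (A : (EuclideanSpace ℝ (Fin 3)) →L[ℝ] (EuclideanSpace ℝ (Fin 3))),
    (∀ (κ : ℝ) (t : Fin 2 → (EuclideanSpace ℝ (Fin 3))) (A : (EuclideanSpace ℝ (Fin 3)) →L[ℝ] (EuclideanSpace ℝ (Fin 3))), 0 < κ → Adm₀ A → Inner₀ t A → Blowdown.PSIneq κ t A →
      ∀ (F g : (EuclideanSpace ℝ (Fin 3)) → (EuclideanSpace ℝ (Fin 3))) (c : (EuclideanSpace ℝ (Fin 3))) (ρ₁ δ ρK R₀ Γ μ : ℝ), 4 ≤ ρ₁ → 1 ≤ δ → δ ≤ ρ₁ → ρ₁ + 2 * δ ≤ ρK → ρK ≤ R₀ →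
        0 ≤ Γ → 0 < μ → (∀ q : Sites₀ t A, R₀ < dist (q : (EuclideanSpace ℝ (Fin 3))) c → F q = 0) →
        (∀ p : Sites₀ t A, dist (p : (EuclideanSpace ℝ (Fin 3))) c ≤ ρ₁ + δ →
          HasSum (fun q : Sites₀ t A => forceConst ((p : (EuclideanSpace ℝ (Fin 3))) - q) (F p - F q)) (g p)) →
        (∀ p : Sites₀ t A, dist (p : (EuclideanSpace ℝ (Fin 3))) c ≤ ρ₁ + δ → ‖g p‖ ^ 2 ≤ Γ) →
        Blowdown.nnEnergy (Sites₀ t A) F c (ρ₁ - 2) ≤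
          C_L / κ * ((δ⁻¹) ^ 2 * Blowdown.oscAt (Sites₀ t A) F c ρK 0 + δ ^ 2 * ρK ^ 3 * Γ +
            (δ⁻¹) ^ 8 * (μ * R₀ ^ 3 * Blowdown.oscAt (Sites₀ t A) F c R₀ 0 +
              μ⁻¹ * ρK ^ 3 * Blowdown.oscAt (Sites₀ t A) F c ρK 0))) →
    0 < κ → Adm₀ A → Inner₀ t A → Blowdown.PSIneq κ t A →
    ∀ (z b zh : (EuclideanSpace ℝ (Fin 3)) → (EuclideanSpace ℝ (Fin 3))) (c m : (EuclideanSpace ℝ (Fin 3))) (R Y₀ Y₂ : ℝ), 400 ≤ R → 0 ≤ Y₀ → 0 ≤ Y₂ →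
      (∀ p ∈ Sites₀ t A, ‖z p - m - b p‖ ≤ Y₀) →
      Summable (fun p : Sites₀ t A => ‖b p‖ ^ 2) → (∑' p : Sites₀ t A, ‖b p‖ ^ 2) ≤ Y₂ ^ 2 →
      Blowdown.IsHarmonicOn (Sites₀ t A) z c R →
      (∀ x, zh x = if dist x c ≤ 4 * R / 5 then z x - m else 0) → 1 ≤ K → C_L / κ ≤ K →
      ∀ e₁ ∈ ({triangularVec₁ 1, triangularVec₂ 1, layerNormal (2 * Real.sqrt (2 / 3))} : Finset (EuclideanSpace ℝ (Fin 3))), ∀ e₂ ∈ ({triangularVec₁ 1, triangularVec₂ 1, layerNormal (2 * Real.sqrt (2 / 3))} : Finset (EuclideanSpace ℝ (Fin 3))),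
        Blowdown.nnEnergy (Sites₀ t A) (fun x => (zh (x + A e₂ + A e₁) - zh (x + A e₂)) - (zh (x + A e₁) - zh x)) c
          (12 * (R / 40) - 2) ≤ 696464110965847557375681269701083136000000 * K * (R⁻¹) ^ 6 * (K * (K * (Blowdown.oscAt (Sites₀ t A) z c R m + Y₀ ^ 2 * R⁻¹ + Y₂ ^ 2 * (R⁻¹) ^ 3))) := by
  intro C_L κ K t A hL hκ hA hI hPS z b zh c m R Y₀ Y₂ hR hY₀ hY₂ ha hb hb2 hz hzh hK1 hKC
  obtain ⟨gens, hgens⟩ : ∃ gens : Finset (EuclideanSpace ℝ (Fin 3)),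
      gens = {triangularVec₁ 1, triangularVec₂ 1, layerNormal (2 * Real.sqrt (2 / 3))} := ⟨_, rfl⟩
  have hgen : ∀ {e : (EuclideanSpace ℝ (Fin 3))}, e ∈ gens → e ∈ Λ₀ ∧ ‖A e‖ ≤ 2 := fun he =>
    Blowdown.gen_mem_and_norm_le hA (by rwa [hgens] at he)
  have hgen' : ∀ {e : (EuclideanSpace ℝ (Fin 3))}, e ∈ gens → e ∈ ({triangularVec₁ 1, triangularVec₂ 1, layerNormal (2 * Real.sqrt (2 / 3))} : Finset (EuclideanSpace ℝ (Fin 3))) := fun he => by rwa [hgens] at he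
  have hR1 : 1 ≤ R := by linarith
  have hR0 : 0 < R := by linarith
  have hR16 : 16 ≤ R := by linarith
  have hR64 : 64 ≤ R := by linarith
  have hK0 : 0 ≤ K := by linarith
  have hosc0 : 0 ≤ Blowdown.oscAt (Sites₀ t A) z c R m := Blowdown.oscAt_nonneg _ _ _ _ _
  have hu0 : 0 ≤ R⁻¹ := by positivity
  have hW₀0 : 0 ≤ (Blowdown.oscAt (Sites₀ t A) z c R m + Y₀ ^ 2 * R⁻¹ + Y₂ ^ 2 * (R⁻¹) ^ 3) := by positivity
  have hYW : Y₀ ^ 2 * R⁻¹ + Y₂ ^ 2 * (R⁻¹) ^ 3 ≤ (Blowdown.oscAt (Sites₀ t A) z c R m + Y₀ ^ 2 * R⁻¹ + Y₂ ^ 2 * (R⁻¹) ^ 3) := by linarith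
  have hoscW : Blowdown.oscAt (Sites₀ t A) z c R m ≤ (Blowdown.oscAt (Sites₀ t A) z c R m + Y₀ ^ 2 * R⁻¹ + Y₂ ^ 2 * (R⁻¹) ^ 3) := by
    have : 0 ≤ Y₀ ^ 2 * R⁻¹ + Y₂ ^ 2 * (R⁻¹) ^ 3 := by positivity
    linarith
  have hY := Blowdown.norm_sub_le_Ybar hY₂ ha hb hb2
  obtain ⟨g₀, hg₀⟩ : ∃ g₀ : (EuclideanSpace ℝ (Fin 3)) → (EuclideanSpace ℝ (Fin 3)), ∀ y, g₀ y =
      ∑' q : Sites₀ t A, (if dist (q : (EuclideanSpace ℝ (Fin 3))) c ≤ 4 * R / 5 then (0 : (EuclideanSpace ℝ (Fin 3)))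
        else forceConst (y - q) (z q - m)) := ⟨_, fun _ => rfl⟩
  have hsupp0 : ∀ q : Sites₀ t A, 4 * R / 5 < dist (q : (EuclideanSpace ℝ (Fin 3))) c → zh q = 0 := fun q hq => by
    rw [hzh, if_neg (not_le.2 hq)]
  have hrows0 : ∀ p : Sites₀ t A, dist (p : (EuclideanSpace ℝ (Fin 3))) c ≤ 4 * R / 5 →
      HasSum (fun q : Sites₀ t A => forceConst ((p : (EuclideanSpace ℝ (Fin 3))) - q) (zh p - zh q)) (g₀ p) := by
    intro p hp
    rw [hg₀]
    exact Blowdown.hasSum_row_localise hA hI hY hz hzh p hp (by linarith)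
  have hM0 : Blowdown.oscAt (Sites₀ t A) zh c (4 * R / 5) 0 ≤ (Blowdown.oscAt (Sites₀ t A) z c R m + Y₀ ^ 2 * R⁻¹ + Y₂ ^ 2 * (R⁻¹) ^ 3) :=
    (Blowdown.oscAt_localise_le hA hI hR0.le hzh).trans hoscW
  have hW1 : (Blowdown.oscAt (Sites₀ t A) z c R m + Y₀ ^ 2 * R⁻¹ + Y₂ ^ 2 * (R⁻¹) ^ 3) ≤ K * (Blowdown.oscAt (Sites₀ t A) z c R m + Y₀ ^ 2 * R⁻¹ + Y₂ ^ 2 * (R⁻¹) ^ 3) := le_mul_of_one_le_left hW₀0 hK1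
  have hKW0 : 0 ≤ K * (Blowdown.oscAt (Sites₀ t A) z c R m + Y₀ ^ 2 * R⁻¹ + Y₂ ^ 2 * (R⁻¹) ^ 3) := by positivity
  have hKKW0 : 0 ≤ K * (K * (Blowdown.oscAt (Sites₀ t A) z c R m + Y₀ ^ 2 * R⁻¹ + Y₂ ^ 2 * (R⁻¹) ^ 3)) := by positivity
  have hW2 : (Blowdown.oscAt (Sites₀ t A) z c R m + Y₀ ^ 2 * R⁻¹ + Y₂ ^ 2 * (R⁻¹) ^ 3) ≤ K * (K * (Blowdown.oscAt (Sites₀ t A) z c R m + Y₀ ^ 2 * R⁻¹ + Y₂ ^ 2 * (R⁻¹) ^ 3)) := hW1.trans (le_mul_of_one_le_left hKW0 hK1)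
  have hE1 := blowdown_level1 C_L κ K t A hL hκ hA hI hPS z b zh c m R Y₀ Y₂ hR hY₀ hY₂ ha hb hb2 hz hzh hK1 hKC
  have hforce2 : ∀ {e₁ e₂ : (EuclideanSpace ℝ (Fin 3))}, e₁ ∈ gens → e₂ ∈ gens →
      ∀ y ∈ Sites₀ t A, dist y c ≤ R / 2 →
      ‖(g₀ (y + A e₂ + A e₁) - g₀ (y + A e₂)) - (g₀ (y + A e₁) - g₀ y)‖ ^ 2 ≤
        10000000000000000000000000000000 * (Y₀ ^ 2 * (R⁻¹) ^ 14 + Y₂ ^ 2 * (R⁻¹) ^ 17) := by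
    intro e₁ e₂ he₁ he₂ y hy hyc
    obtain ⟨he₁Λ, hAe₁⟩ := hgen he₁
    obtain ⟨he₂Λ, hAe₂⟩ := hgen he₂
    have e : (g₀ (y + A e₂ + A e₁) - g₀ (y + A e₂)) - (g₀ (y + A e₁) - g₀ y) =
        g₀ (y + A e₂ + A e₁) - g₀ (y + A e₂) - g₀ (y + A e₁) + g₀ y := by abel
    rw [e, hg₀, hg₀, hg₀, hg₀]
    exact Blowdown.farField_sq_le₂ hA hI hR64 hY₀ hY₂ ha hb hb2 hy (add_mem_sites₀ hy he₁Λ) (add_mem_sites₀ hy he₂Λ)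
      (add_mem_sites₀ (add_mem_sites₀ hy he₂Λ) he₁Λ) hyc hAe₁ hAe₂
  intro e₁ he₁g e₂ he₂g
  have he₁ : e₁ ∈ gens := by rw [hgens]; exact he₁g
  have he₂ : e₂ ∈ gens := by rw [hgens]; exact he₂g
  obtain ⟨he₁Λ, hAe₁⟩ := hgen he₁
  obtain ⟨he₂Λ, hAe₂⟩ := hgen he₂
  obtain ⟨hmass1, hsupp1⟩ := Blowdown.oscAt_diff_le hA hI he₁Λ hAe₁ hsupp0
  have hrows1 := Blowdown.rows_diff he₁Λ hAe₁ hrows0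
  have h := Blowdown.next_level hL hκ hA hI hPS (F := fun x => zh (x + A e₁) - zh x)
      (gF := fun y => g₀ (y + A e₁) - g₀ y) (k := 2) (a := 4 * 26567997390205855334410240000) (g := 10000000000000000000000000000000)
      (Γb := 10000000000000000000000000000000 * (Y₀ ^ 2 * (R⁻¹) ^ 14 + Y₂ ^ 2 * (R⁻¹) ^ 17)) (W := K * (K * (Blowdown.oscAt (Sites₀ t A) z c R m + Y₀ ^ 2 * R⁻¹ + Y₂ ^ 2 * (R⁻¹) ^ 3))) (R₀ := 4 * R / 5 + 2)
      (ρ := 4 * R / 5 - 2) (e := e₂) (by norm_num) (by norm_num) hR he₂g hK1 hKC hKKW0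
      (by positivity) (by norm_num) hsupp1 (by linarith) (by linarith) hrows1 (by push_cast; linarith) ?_ (by positivity)
      ?_ ?_ ?_
  · have hc : ((1600 * (4 * 26567997390205855334410240000) + 10000000000000000000000000000000 + 40 ^ 8 * (4 ^ 2 + 4 * 26567997390205855334410240000)) : ℝ) * K * (R⁻¹) ^ (2 * 2 + 2) *
        (K * (K * (Blowdown.oscAt (Sites₀ t A) z c R m + Y₀ ^ 2 * R⁻¹ + Y₂ ^ 2 * (R⁻¹) ^ 3))) = 696464110965847557375681269701083136000000 * K * (R⁻¹) ^ 6 * (K * (K * (Blowdown.oscAt (Sites₀ t A) z c R m + Y₀ ^ 2 * R⁻¹ + Y₂ ^ 2 * (R⁻¹) ^ 3))) := by norm_num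
    have e : (18 - 3 * ((2 : ℕ) : ℝ)) * (R / 40) - 2 = 12 * (R / 40) - 2 := by push_cast; ring
    rw [hc, e] at h
    exact h
  · intro p hp
    push_cast at hp
    exact hforce2 he₁ he₂ p p.2 (by linarith)
  · exact Blowdown.forcing_arith hR1 (hYW.trans hW2) (by norm_num) (n := 6) (m := 2 * 2 + 2) (by norm_num)
      (le_of_eq (by norm_num))
  · rw [show ((4 : ℝ)) ^ (2 - 1) = 4 by norm_num]
    calc Blowdown.oscAt (Sites₀ t A) (fun x => zh (x + A e₁) - zh x) c (4 * R / 5 + 2) 0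
        ≤ 4 * Blowdown.oscAt (Sites₀ t A) zh c (4 * R / 5) 0 := hmass1
      _ ≤ 4 * (K * (K * (Blowdown.oscAt (Sites₀ t A) z c R m + Y₀ ^ 2 * R⁻¹ + Y₂ ^ 2 * (R⁻¹) ^ 3))) := by linarith [hM0.trans hW2]
  · have e : (21 - 3 * ((2 : ℕ) : ℝ)) * (R / 40) - 2 = 15 * (R / 40) - 2 := by push_cast; ring
    rw [e]
    calc 4 * Blowdown.nnEnergy (Sites₀ t A) (fun x => zh (x + A e₁) - zh x) c (15 * (R / 40) - 2)
        ≤ 4 * (26567997390205855334410240000 * K * (R⁻¹) ^ 4 * (K * (Blowdown.oscAt (Sites₀ t A) z c R m + Y₀ ^ 2 * R⁻¹ + Y₂ ^ 2 * (R⁻¹) ^ 3))) := by linarith [hE1 e₁ he₁g]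
      _ = 4 * 26567997390205855334410240000 * (R⁻¹) ^ (2 * 2) * (K * (K * (Blowdown.oscAt (Sites₀ t A) z c R m + Y₀ ^ 2 * R⁻¹ + Y₂ ^ 2 * (R⁻¹) ^ 3))) := by ring

/-- **Level `3`**: the energy of each triple generator difference of the localised field on `B_{9R/40 − 2}(c)` is
`≤ A₃·K⁴·R⁻⁸·W`. [folklore] -/
theorem blowdown_level3 : ∀ (C_L κ K : ℝ) (t : Fin 2 → (EuclideanSpace ℝ (Fin 3))) (A : (EuclideanSpace ℝ (Fin 3)) →L[ℝ] (EuclideanSpace ℝ (Fin 3))),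
    (∀ (κ : ℝ) (t : Fin 2 → (EuclideanSpace ℝ (Fin 3))) (A : (EuclideanSpace ℝ (Fin 3)) →L[ℝ] (EuclideanSpace ℝ (Fin 3))), 0 < κ → Adm₀ A → Inner₀ t A → Blowdown.PSIneq κ t A →
      ∀ (F g : (EuclideanSpace ℝ (Fin 3)) → (EuclideanSpace ℝ (Fin 3))) (c : (EuclideanSpace ℝ (Fin 3))) (ρ₁ δ ρK R₀ Γ μ : ℝ), 4 ≤ ρ₁ → 1 ≤ δ → δ ≤ ρ₁ → ρ₁ + 2 * δ ≤ ρK → ρK ≤ R₀ →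
        0 ≤ Γ → 0 < μ → (∀ q : Sites₀ t A, R₀ < dist (q : (EuclideanSpace ℝ (Fin 3))) c → F q = 0) →
        (∀ p : Sites₀ t A, dist (p : (EuclideanSpace ℝ (Fin 3))) c ≤ ρ₁ + δ →
          HasSum (fun q : Sites₀ t A => forceConst ((p : (EuclideanSpace ℝ (Fin 3))) - q) (F p - F q)) (g p)) →
        (∀ p : Sites₀ t A, dist (p : (EuclideanSpace ℝ (Fin 3))) c ≤ ρ₁ + δ → ‖g p‖ ^ 2 ≤ Γ) →
        Blowdown.nnEnergy (Sites₀ t A) F c (ρ₁ - 2) ≤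
          C_L / κ * ((δ⁻¹) ^ 2 * Blowdown.oscAt (Sites₀ t A) F c ρK 0 + δ ^ 2 * ρK ^ 3 * Γ +
            (δ⁻¹) ^ 8 * (μ * R₀ ^ 3 * Blowdown.oscAt (Sites₀ t A) F c R₀ 0 +
              μ⁻¹ * ρK ^ 3 * Blowdown.oscAt (Sites₀ t A) F c ρK 0))) →
    0 < κ → Adm₀ A → Inner₀ t A → Blowdown.PSIneq κ t A →
    ∀ (z b zh : (EuclideanSpace ℝ (Fin 3)) → (EuclideanSpace ℝ (Fin 3))) (c m : (EuclideanSpace ℝ (Fin 3))) (R Y₀ Y₂ : ℝ), 400 ≤ R → 0 ≤ Y₀ → 0 ≤ Y₂ →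
      (∀ p ∈ Sites₀ t A, ‖z p - m - b p‖ ≤ Y₀) →
      Summable (fun p : Sites₀ t A => ‖b p‖ ^ 2) → (∑' p : Sites₀ t A, ‖b p‖ ^ 2) ≤ Y₂ ^ 2 →
      Blowdown.IsHarmonicOn (Sites₀ t A) z c R →
      (∀ x, zh x = if dist x c ≤ 4 * R / 5 then z x - m else 0) → 1 ≤ K → C_L / κ ≤ K →
      ∀ e₁ ∈ ({triangularVec₁ 1, triangularVec₂ 1, layerNormal (2 * Real.sqrt (2 / 3))} : Finset (EuclideanSpace ℝ (Fin 3))), ∀ e₂ ∈ ({triangularVec₁ 1, triangularVec₂ 1, layerNormal (2 * Real.sqrt (2 / 3))} : Finset (EuclideanSpace ℝ (Fin 3))), ∀ e₃ ∈ ({triangularVec₁ 1, triangularVec₂ 1, layerNormal (2 * Real.sqrt (2 / 3))} : Finset (EuclideanSpace ℝ (Fin 3))),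
        Blowdown.nnEnergy (Sites₀ t A) (fun x => ((zh (x + A e₃ + A e₂ + A e₁) - zh (x + A e₃ + A e₂)) -
          (zh (x + A e₃ + A e₁) - zh (x + A e₃))) - ((zh (x + A e₂ + A e₁) - zh (x + A e₂)) - (zh (x + A e₁) - zh x))) c
          (9 * (R / 40) - 2) ≤ 18257388794960484518250523443656433886445751500800000000 * K * (R⁻¹) ^ 8 * (K * (K * (K * (Blowdown.oscAt (Sites₀ t A) z c R m + Y₀ ^ 2 * R⁻¹ + Y₂ ^ 2 * (R⁻¹) ^ 3)))) := by
  intro C_L κ K t A hL hκ hA hI hPS z b zh c m R Y₀ Y₂ hR hY₀ hY₂ ha hb hb2 hz hzh hK1 hKC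
  obtain ⟨gens, hgens⟩ : ∃ gens : Finset (EuclideanSpace ℝ (Fin 3)),
      gens = {triangularVec₁ 1, triangularVec₂ 1, layerNormal (2 * Real.sqrt (2 / 3))} := ⟨_, rfl⟩
  have hgen : ∀ {e : (EuclideanSpace ℝ (Fin 3))}, e ∈ gens → e ∈ Λ₀ ∧ ‖A e‖ ≤ 2 := fun he =>
    Blowdown.gen_mem_and_norm_le hA (by rwa [hgens] at he)
  have hgen' : ∀ {e : (EuclideanSpace ℝ (Fin 3))}, e ∈ gens → e ∈ ({triangularVec₁ 1, triangularVec₂ 1, layerNormal (2 * Real.sqrt (2 / 3))} : Finset (EuclideanSpace ℝ (Fin 3))) := fun he => by rwa [hgens] at he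
  have hR1 : 1 ≤ R := by linarith
  have hR0 : 0 < R := by linarith
  have hR16 : 16 ≤ R := by linarith
  have hR64 : 64 ≤ R := by linarith
  have hK0 : 0 ≤ K := by linarith
  have hosc0 : 0 ≤ Blowdown.oscAt (Sites₀ t A) z c R m := Blowdown.oscAt_nonneg _ _ _ _ _
  have hu0 : 0 ≤ R⁻¹ := by positivity
  have hW₀0 : 0 ≤ (Blowdown.oscAt (Sites₀ t A) z c R m + Y₀ ^ 2 * R⁻¹ + Y₂ ^ 2 * (R⁻¹) ^ 3) := by positivity
  have hYW : Y₀ ^ 2 * R⁻¹ + Y₂ ^ 2 * (R⁻¹) ^ 3 ≤ (Blowdown.oscAt (Sites₀ t A) z c R m + Y₀ ^ 2 * R⁻¹ + Y₂ ^ 2 * (R⁻¹) ^ 3) := by linarith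
  have hoscW : Blowdown.oscAt (Sites₀ t A) z c R m ≤ (Blowdown.oscAt (Sites₀ t A) z c R m + Y₀ ^ 2 * R⁻¹ + Y₂ ^ 2 * (R⁻¹) ^ 3) := by
    have : 0 ≤ Y₀ ^ 2 * R⁻¹ + Y₂ ^ 2 * (R⁻¹) ^ 3 := by positivity
    linarith
  have hY := Blowdown.norm_sub_le_Ybar hY₂ ha hb hb2
  obtain ⟨g₀, hg₀⟩ : ∃ g₀ : (EuclideanSpace ℝ (Fin 3)) → (EuclideanSpace ℝ (Fin 3)), ∀ y, g₀ y =
      ∑' q : Sites₀ t A, (if dist (q : (EuclideanSpace ℝ (Fin 3))) c ≤ 4 * R / 5 then (0 : (EuclideanSpace ℝ (Fin 3)))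
        else forceConst (y - q) (z q - m)) := ⟨_, fun _ => rfl⟩
  have hsupp0 : ∀ q : Sites₀ t A, 4 * R / 5 < dist (q : (EuclideanSpace ℝ (Fin 3))) c → zh q = 0 := fun q hq => by
    rw [hzh, if_neg (not_le.2 hq)]
  have hrows0 : ∀ p : Sites₀ t A, dist (p : (EuclideanSpace ℝ (Fin 3))) c ≤ 4 * R / 5 →
      HasSum (fun q : Sites₀ t A => forceConst ((p : (EuclideanSpace ℝ (Fin 3))) - q) (zh p - zh q)) (g₀ p) := by
    intro p hp
    rw [hg₀]
    exact Blowdown.hasSum_row_localise hA hI hY hz hzh p hp (by linarith)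
  have hM0 : Blowdown.oscAt (Sites₀ t A) zh c (4 * R / 5) 0 ≤ (Blowdown.oscAt (Sites₀ t A) z c R m + Y₀ ^ 2 * R⁻¹ + Y₂ ^ 2 * (R⁻¹) ^ 3) :=
    (Blowdown.oscAt_localise_le hA hI hR0.le hzh).trans hoscW
  have hW1 : (Blowdown.oscAt (Sites₀ t A) z c R m + Y₀ ^ 2 * R⁻¹ + Y₂ ^ 2 * (R⁻¹) ^ 3) ≤ K * (Blowdown.oscAt (Sites₀ t A) z c R m + Y₀ ^ 2 * R⁻¹ + Y₂ ^ 2 * (R⁻¹) ^ 3) := le_mul_of_one_le_left hW₀0 hK1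
  have hKW0 : 0 ≤ K * (Blowdown.oscAt (Sites₀ t A) z c R m + Y₀ ^ 2 * R⁻¹ + Y₂ ^ 2 * (R⁻¹) ^ 3) := by positivity
  have hKKW0 : 0 ≤ K * (K * (Blowdown.oscAt (Sites₀ t A) z c R m + Y₀ ^ 2 * R⁻¹ + Y₂ ^ 2 * (R⁻¹) ^ 3)) := by positivity
  have hW2 : (Blowdown.oscAt (Sites₀ t A) z c R m + Y₀ ^ 2 * R⁻¹ + Y₂ ^ 2 * (R⁻¹) ^ 3) ≤ K * (K * (Blowdown.oscAt (Sites₀ t A) z c R m + Y₀ ^ 2 * R⁻¹ + Y₂ ^ 2 * (R⁻¹) ^ 3)) := hW1.trans (le_mul_of_one_le_left hKW0 hK1)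
  have hW3 : (Blowdown.oscAt (Sites₀ t A) z c R m + Y₀ ^ 2 * R⁻¹ + Y₂ ^ 2 * (R⁻¹) ^ 3) ≤ K * (K * (K * (Blowdown.oscAt (Sites₀ t A) z c R m + Y₀ ^ 2 * R⁻¹ + Y₂ ^ 2 * (R⁻¹) ^ 3))) := hW2.trans (le_mul_of_one_le_left hKKW0 hK1)
  have hE2 := blowdown_level2 C_L κ K t A hL hκ hA hI hPS z b zh c m R Y₀ Y₂ hR hY₀ hY₂ ha hb hb2 hz hzh hK1 hKC
  have hforce2 : ∀ {e₁ e₂ : (EuclideanSpace ℝ (Fin 3))}, e₁ ∈ gens → e₂ ∈ gens →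
      ∀ y ∈ Sites₀ t A, dist y c ≤ R / 2 →
      ‖(g₀ (y + A e₂ + A e₁) - g₀ (y + A e₂)) - (g₀ (y + A e₁) - g₀ y)‖ ^ 2 ≤
        10000000000000000000000000000000 * (Y₀ ^ 2 * (R⁻¹) ^ 14 + Y₂ ^ 2 * (R⁻¹) ^ 17) := by
    intro e₁ e₂ he₁ he₂ y hy hyc
    obtain ⟨he₁Λ, hAe₁⟩ := hgen he₁
    obtain ⟨he₂Λ, hAe₂⟩ := hgen he₂
    have e : (g₀ (y + A e₂ + A e₁) - g₀ (y + A e₂)) - (g₀ (y + A e₁) - g₀ y) =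
        g₀ (y + A e₂ + A e₁) - g₀ (y + A e₂) - g₀ (y + A e₁) + g₀ y := by abel
    rw [e, hg₀, hg₀, hg₀, hg₀]
    exact Blowdown.farField_sq_le₂ hA hI hR64 hY₀ hY₂ ha hb hb2 hy (add_mem_sites₀ hy he₁Λ) (add_mem_sites₀ hy he₂Λ)
      (add_mem_sites₀ (add_mem_sites₀ hy he₂Λ) he₁Λ) hyc hAe₁ hAe₂
  intro e₁ he₁g e₂ he₂g e₃ he₃g
  have he₁ : e₁ ∈ gens := by rw [hgens]; exact he₁g
  have he₂ : e₂ ∈ gens := by rw [hgens]; exact he₂g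
  have he₃ : e₃ ∈ gens := by rw [hgens]; exact he₃g
  obtain ⟨he₁Λ, hAe₁⟩ := hgen he₁
  obtain ⟨he₂Λ, hAe₂⟩ := hgen he₂
  obtain ⟨he₃Λ, hAe₃⟩ := hgen he₃
  obtain ⟨hmass1, hsupp1⟩ := Blowdown.oscAt_diff_le hA hI he₁Λ hAe₁ hsupp0
  have hrows1 := Blowdown.rows_diff he₁Λ hAe₁ hrows0
  obtain ⟨hmass2, hsupp2⟩ := Blowdown.oscAt_diff_le hA hI (F := fun x => zh (x + A e₁) - zh x) he₂Λ hAe₂ hsupp1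
  have hrows2 := Blowdown.rows_diff (F := fun x => zh (x + A e₁) - zh x) (g := fun y => g₀ (y + A e₁) - g₀ y)
    he₂Λ hAe₂ hrows1
  have hsupp2' : ∀ q : Sites₀ t A, 4 * R / 5 + 4 < dist (q : (EuclideanSpace ℝ (Fin 3))) c →
      (zh ((q : (EuclideanSpace ℝ (Fin 3))) + A e₂ + A e₁) - zh ((q : (EuclideanSpace ℝ (Fin 3))) + A e₂)) -
        (zh ((q : (EuclideanSpace ℝ (Fin 3))) + A e₁) - zh q) = 0 := fun q hq => hsupp2 q (by linarith only [hq])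
  have hrows2' : ∀ p : Sites₀ t A, dist (p : (EuclideanSpace ℝ (Fin 3))) c ≤ 4 * R / 5 - 4 →
      HasSum (fun q : Sites₀ t A => forceConst ((p : (EuclideanSpace ℝ (Fin 3))) - q)
        (((zh ((p : (EuclideanSpace ℝ (Fin 3))) + A e₂ + A e₁) - zh ((p : (EuclideanSpace ℝ (Fin 3))) + A e₂)) -
          (zh ((p : (EuclideanSpace ℝ (Fin 3))) + A e₁) - zh p)) -
         ((zh ((q : (EuclideanSpace ℝ (Fin 3))) + A e₂ + A e₁) - zh ((q : (EuclideanSpace ℝ (Fin 3))) + A e₂)) -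
          (zh ((q : (EuclideanSpace ℝ (Fin 3))) + A e₁) - zh q))))
        ((g₀ ((p : (EuclideanSpace ℝ (Fin 3))) + A e₂ + A e₁) - g₀ ((p : (EuclideanSpace ℝ (Fin 3))) + A e₂)) -
          (g₀ ((p : (EuclideanSpace ℝ (Fin 3))) + A e₁) - g₀ p)) := fun p hp => hrows2 p (by linarith only [hp])
  have hρ3 : (19 - 3 * ((3 : ℕ) : ℝ)) * (R / 40) + 2 ≤ 4 * R / 5 - 4 := by push_cast; linarith only [hR]
  have hR₀a : 4 * R / 5 ≤ 4 * R / 5 + 4 := le_add_of_nonneg_right (by norm_num)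
  have hR₀b : 4 * R / 5 + 4 + 2 ≤ R := by linarith only [hR]
  have hforce3 : ∀ p : Sites₀ t A, dist (p : (EuclideanSpace ℝ (Fin 3))) c ≤ (19 - 3 * ((3 : ℕ) : ℝ)) * (R / 40) →
      ‖((g₀ ((p : (EuclideanSpace ℝ (Fin 3))) + A e₃ + A e₂ + A e₁) - g₀ ((p : (EuclideanSpace ℝ (Fin 3))) + A e₃ + A e₂)) -
          (g₀ ((p : (EuclideanSpace ℝ (Fin 3))) + A e₃ + A e₁) - g₀ ((p : (EuclideanSpace ℝ (Fin 3))) + A e₃))) -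
        ((g₀ ((p : (EuclideanSpace ℝ (Fin 3))) + A e₂ + A e₁) - g₀ ((p : (EuclideanSpace ℝ (Fin 3))) + A e₂)) -
          (g₀ ((p : (EuclideanSpace ℝ (Fin 3))) + A e₁) - g₀ p))‖ ^ 2 ≤
      4 * (10000000000000000000000000000000 * (Y₀ ^ 2 * (R⁻¹) ^ 14 + Y₂ ^ 2 * (R⁻¹) ^ 17)) := by
    intro p hp
    push_cast at hp
    have hp3 : (p : (EuclideanSpace ℝ (Fin 3))) + A e₃ ∈ Sites₀ t A := add_mem_sites₀ p.2 he₃Λ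
    have hd3 : dist ((p : (EuclideanSpace ℝ (Fin 3))) + A e₃) c ≤ R / 2 := by
      have h1 : dist ((p : (EuclideanSpace ℝ (Fin 3))) + A e₃) p = ‖A e₃‖ := by rw [dist_eq_norm, add_sub_cancel_left]
      have h2 := dist_triangle ((p : (EuclideanSpace ℝ (Fin 3))) + A e₃) p c
      linarith only [h1, h2, hp, hAe₃, hR]
    have hX := hforce2 he₁ he₂ _ hp3 hd3
    have hY' := hforce2 he₁ he₂ p p.2 (by linarith only [hp, hR])
    have hsq := norm_sub_le
      ((g₀ ((p : (EuclideanSpace ℝ (Fin 3))) + A e₃ + A e₂ + A e₁) - g₀ ((p : (EuclideanSpace ℝ (Fin 3))) + A e₃ + A e₂)) -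
        (g₀ ((p : (EuclideanSpace ℝ (Fin 3))) + A e₃ + A e₁) - g₀ ((p : (EuclideanSpace ℝ (Fin 3))) + A e₃)))
      ((g₀ ((p : (EuclideanSpace ℝ (Fin 3))) + A e₂ + A e₁) - g₀ ((p : (EuclideanSpace ℝ (Fin 3))) + A e₂)) -
        (g₀ ((p : (EuclideanSpace ℝ (Fin 3))) + A e₁) - g₀ p))
    have h2 := pow_le_pow_left₀ (norm_nonneg _) hsq 2
    nlinarith only [h2, hX, hY',
      sq_nonneg (‖(g₀ ((p : (EuclideanSpace ℝ (Fin 3))) + A e₃ + A e₂ + A e₁) - g₀ ((p : (EuclideanSpace ℝ (Fin 3))) + A e₃ + A e₂)) -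
        (g₀ ((p : (EuclideanSpace ℝ (Fin 3))) + A e₃ + A e₁) - g₀ ((p : (EuclideanSpace ℝ (Fin 3))) + A e₃))‖ -
        ‖(g₀ ((p : (EuclideanSpace ℝ (Fin 3))) + A e₂ + A e₁) - g₀ ((p : (EuclideanSpace ℝ (Fin 3))) + A e₂)) -
        (g₀ ((p : (EuclideanSpace ℝ (Fin 3))) + A e₁) - g₀ p)‖)]
  have hΓ3 : R ^ 5 * (4 * (10000000000000000000000000000000 * (Y₀ ^ 2 * (R⁻¹) ^ 14 + Y₂ ^ 2 * (R⁻¹) ^ 17))) ≤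
      (4 * 10000000000000000000000000000000) * (R⁻¹) ^ (2 * 3 + 2) * (K * (K * (K * (Blowdown.oscAt (Sites₀ t A) z c R m + Y₀ ^ 2 * R⁻¹ + Y₂ ^ 2 * (R⁻¹) ^ 3)))) :=
    Blowdown.forcing_arith hR1 (hYW.trans hW3) (by norm_num) (n := 6) (m := 2 * 3 + 2) (by norm_num) (le_of_eq (by ring))
  have hMF3 : Blowdown.oscAt (Sites₀ t A) (fun x => (zh (x + A e₂ + A e₁) - zh (x + A e₂)) - (zh (x + A e₁) - zh x)) c
      (4 * R / 5 + 4) 0 ≤ 4 ^ (3 - 1) * (K * (K * (K * (Blowdown.oscAt (Sites₀ t A) z c R m + Y₀ ^ 2 * R⁻¹ + Y₂ ^ 2 * (R⁻¹) ^ 3)))) := by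
    rw [show ((4 : ℝ)) ^ (3 - 1) = 16 by norm_num]
    have e4 : (4 * R / 5 + 2 + 2 : ℝ) = 4 * R / 5 + 4 := by ring
    rw [e4] at hmass2
    have h16 := hM0.trans hW3
    linarith only [hmass2, hmass1, h16]
  have hEF3 : 4 * Blowdown.nnEnergy (Sites₀ t A) (fun x => (zh (x + A e₂ + A e₁) - zh (x + A e₂)) - (zh (x + A e₁) - zh x)) c
      ((21 - 3 * ((3 : ℕ) : ℝ)) * (R / 40) - 2) ≤ 4 * 696464110965847557375681269701083136000000 * (R⁻¹) ^ (2 * 3) * (K * (K * (K * (Blowdown.oscAt (Sites₀ t A) z c R m + Y₀ ^ 2 * R⁻¹ + Y₂ ^ 2 * (R⁻¹) ^ 3)))) := by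
    have e : (21 - 3 * ((3 : ℕ) : ℝ)) * (R / 40) - 2 = 12 * (R / 40) - 2 := by push_cast; ring
    rw [e]
    have h := hE2 e₁ he₁g e₂ he₂g
    calc 4 * Blowdown.nnEnergy (Sites₀ t A) (fun x => (zh (x + A e₂ + A e₁) - zh (x + A e₂)) - (zh (x + A e₁) - zh x)) c
          (12 * (R / 40) - 2) ≤ 4 * (696464110965847557375681269701083136000000 * K * (R⁻¹) ^ 6 * (K * (K * (Blowdown.oscAt (Sites₀ t A) z c R m + Y₀ ^ 2 * R⁻¹ + Y₂ ^ 2 * (R⁻¹) ^ 3)))) := by linarith only [h]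
      _ = 4 * 696464110965847557375681269701083136000000 * (R⁻¹) ^ (2 * 3) * (K * (K * (K * (Blowdown.oscAt (Sites₀ t A) z c R m + Y₀ ^ 2 * R⁻¹ + Y₂ ^ 2 * (R⁻¹) ^ 3)))) := by ring
  have h := Blowdown.next_level hL hκ hA hI hPS (F := fun x => (zh (x + A e₂ + A e₁) - zh (x + A e₂)) - (zh (x + A e₁) - zh x))
    (gF := fun y => (g₀ (y + A e₂ + A e₁) - g₀ (y + A e₂)) - (g₀ (y + A e₁) - g₀ y)) (e := e₃) (R₀ := 4 * R / 5 + 4)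
    (ρ := 4 * R / 5 - 4) (k := 3) (a := 4 * 696464110965847557375681269701083136000000) (g := 4 * 10000000000000000000000000000000)
    (Γb := 4 * (10000000000000000000000000000000 * (Y₀ ^ 2 * (R⁻¹) ^ 14 + Y₂ ^ 2 * (R⁻¹) ^ 17))) (W := K * (K * (K * (Blowdown.oscAt (Sites₀ t A) z c R m + Y₀ ^ 2 * R⁻¹ + Y₂ ^ 2 * (R⁻¹) ^ 3))))
    (by norm_num) (by norm_num) hR he₃g hK1 hKC (by positivity) (by positivity)
    (by norm_num) hsupp2' hR₀a hR₀b hrows2' hρ3 hforce3 (by positivity) hΓ3 hMF3 hEF3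
  have hc : ((1600 * (4 * 696464110965847557375681269701083136000000) + 4 * 10000000000000000000000000000000 + 40 ^ 8 * (4 ^ 3 + 4 * 696464110965847557375681269701083136000000)) : ℝ) * K * (R⁻¹) ^ (2 * 3 + 2) *
      (K * (K * (K * (Blowdown.oscAt (Sites₀ t A) z c R m + Y₀ ^ 2 * R⁻¹ + Y₂ ^ 2 * (R⁻¹) ^ 3)))) = 18257388794960484518250523443656433886445751500800000000 * K * (R⁻¹) ^ 8 * (K * (K * (K * (Blowdown.oscAt (Sites₀ t A) z c R m + Y₀ ^ 2 * R⁻¹ + Y₂ ^ 2 * (R⁻¹) ^ 3)))) := by norm_num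
  have e : (18 - 3 * ((3 : ℕ) : ℝ)) * (R / 40) - 2 = 9 * (R / 40) - 2 := by push_cast; ring
  rw [hc, e] at h
  exact h

end Summit.AtomisticToContinuum.Crystallization.Theorems.ExcessDecayLiouville

end
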